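import Summits.QuantumFields.YangMills.Theorems.EntropyBudgetEquipartitionTransferOfTwoSignedSource
import Literature.MathematicalPhysics.QuantumLattice.LatticeGaugeDLRLimitPointsProofs
import HarnessLib

/-!
# Route `EntropyBudgetEquipartition`, crux `EntropyBudgetTransfer` (stmt-QuantumFields-22401) — the crux in the vocabulary of infinite-volume limit states

HONEST LABEL: helper lemmas toward a RECORD-label rung (R2ξ-G, `WeakCouplingRates.XiPow`, an UPPER bound on the lattice gap);
nothing here bears on the Clay Yang–Mills mass gap, which is NOT proved by any of this.

The crux is stated on finite tori («for `β ≥ β₀` and `1 ≤ n ≤ 2β^A`, EVENTUALLY IN THE TORUS SIZE `L+1`,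
`|β² Cov_{β,Λ_{L+1}}(c₀, c_{n e₀}) − σ C(n)²| ≤ C β^(−κ)`»).  The entropy method (specific relative entropy, the Gibbs variational
principle, DLR) lives on infinite-volume states.  This file proves the two formulations equivalent, the torus-limit states being the
tree's `infiniteVolumeLimitPoints r.ρ β` (subsequential weak limits of the torus Wilson states on bounded continuous cylinder
observables):

* `exists_limitAlong_subseq` — compactness along ANY subsequence of torus sizes: every subsequence of the torus Wilson states has a
  further subsequence converging to a limit point (the tree's `infiniteVolumeLimitPoints_nonempty_holds` is the case of the full
  sequence);
* `eventually_abs_sub_le_of_subseq_limits` — the real-sequence lemma: if along every subsequence some further subsequence of `x`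
  converges to a point of `[t − ε, t + ε]`, then `|x_L − t| ≤ ε + δ` eventually, for every `δ > 0`;
* `tendsto_cov_along` — along the tori defining a limit state `μ`, the torus covariances `Cov_{β,Λ_{L_k+1}}(c₀, c_{n e₀})` converge to
  the `μ`-covariance `∫ c₀ c_{n e₀} dμ − ∫ c₀ dμ ∫ c_{n e₀} dμ`;
* `limitStates_of_eventually` / `eventually_of_limitStates` — the two-sided law at precision `ε` eventually on the tori ⇒ at
  precision `ε` for every limit state; and at precision `ε` for every limit state ⇒ at precision `ε + δ` eventually on the tori;
* `entropyBudgetTransfer_iff_limitStates` — hence `EntropyBudgetTransfer ↔` «for every compact simple `G` and `r` there are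
  `κ, A, σ > 0`, `C`, `β₀` with `|β² Cov_μ(c₀, c_{n e₀}) − σ C(n)²| ≤ C β^(−κ)` for all `β ≥ β₀`, `1 ≤ n ≤ 2β^A` and EVERY
  `μ ∈ infiniteVolumeLimitPoints r.ρ β`» (K1's hypothesis discharged by `FreeEnergyRate_of` on the way).

[folklore]
-/

noncomputable section

namespace Summit.QuantumFields.YangMills.Theorems.EntropyBudgetEquipartition.LimitStates

open MeasureTheory Filter Topology
open Literature.MathematicalPhysics.QuantumFieldTheory Literature.MathematicalPhysics.QuantumLattice
  Summit.QuantumFields.YangMills.Theorems.WeakCouplingRates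
  Summit.QuantumFields.YangMills.Theorems.EntropyBudgetEquipartition.TwoSignedSource

/-! ### A real-sequence lemma -/

/-- If along every subsequence of `x` some further subsequence converges to a point within `ε` of `t`, then for every `δ > 0`,
eventually `|x L − t| ≤ ε + δ`. [folklore] -/
theorem eventually_abs_sub_le_of_subseq_limits {x : ℕ → ℝ} {t ε δ : ℝ} (hδ : 0 < δ)
    (h : ∀ ψ : ℕ → ℕ, StrictMono ψ → ∃ φ : ℕ → ℕ, StrictMono φ ∧ ∃ y : ℝ, |y - t| ≤ ε ∧
      Tendsto (fun k => x (ψ (φ k))) atTop (𝓝 y)) :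
    ∀ᶠ L : ℕ in atTop, |x L - t| ≤ ε + δ := by
  by_contra hne
  have hfreq : ∃ᶠ L : ℕ in atTop, ¬ |x L - t| ≤ ε + δ := Filter.not_eventually.1 hne
  obtain ⟨ψ, hψ, hbad⟩ := Filter.extraction_of_frequently_atTop hfreq
  obtain ⟨φ, hφ, y, hy, hlim⟩ := h ψ hψ
  have habs : Tendsto (fun k => |x (ψ (φ k)) - t|) atTop (𝓝 |y - t|) :=
    (continuous_abs.tendsto _).comp (hlim.sub_const t)
  have hge : ε + δ ≤ |y - t| :=
    ge_of_tendsto' habs fun k => (lt_of_not_ge (hbad (φ k))).le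
  linarith

/-! ### Limit states along arbitrary subsequences of tori -/

section Wilson

variable (G : Type) [Group G] [TopologicalSpace G] [IsTopologicalGroup G] [CompactSpace G]
  [MeasurableSpace G] [BorelSpace G] (r : LatticeRep G)

/-- **Compactness along a subsequence**: for a faithful continuous unitary lattice representation `r` of the compact group `G`, every
subsequence `ψ` of torus sizes has a further subsequence `ψ ∘ φ` along which the torus Wilson states converge to an infinite-volume
limit state (Riesz–Markov/Prokhorov on the compact metrisable `G^{edges(ℤ⁴)}`, as in the tree's
`infiniteVolumeLimitPoints_nonempty_holds`). [folklore] -/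
theorem exists_limitAlong_subseq (β : ℝ) (ψ : ℕ → ℕ) :
    ∃ φ : ℕ → ℕ, StrictMono φ ∧ ∃ μ : Measure (LGConfig 4 G), IsInfiniteVolumeLimitAlong (d := 4) r.ρ β (ψ ∘ φ) μ := by
  haveI : SecondCountableTopology (Matrix (Fin r.N) (Fin r.N) ℂ) :=
    inferInstanceAs (SecondCountableTopology (Fin r.N → Fin r.N → ℂ))
  haveI : SecondCountableTopology G :=
    (r.continuous.isClosedEmbedding r.injective).isEmbedding.secondCountableTopology
  haveI : T2Space G := (r.continuous.isClosedEmbedding r.injective).isEmbedding.t2Space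
  haveI := fun L : ℕ => isProbabilityMeasure_torusState (d := 4) (L := L + 1) r.ρ r.continuous β
  let P : ℕ → ProbabilityMeasure (LGConfig 4 G) := fun L => ⟨torusState r.ρ β (L + 1), inferInstance⟩
  obtain ⟨μ, -, φ, hφ, hlim⟩ :=
    (isCompact_univ (X := ProbabilityMeasure (LGConfig 4 G))).tendsto_subseq fun n => Set.mem_univ (P (ψ n))
  refine ⟨φ, hφ, (μ : Measure (LGConfig 4 G)), inferInstance, fun F S _ hFc hFb => ?_⟩
  obtain ⟨C, hC⟩ := hFb
  let Fb : BoundedContinuousFunction (LGConfig 4 G) ℝ :=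
    BoundedContinuousFunction.ofNormedAddCommGroup F hFc C (fun U => by simpa [Real.norm_eq_abs] using hC U)
  have hE : (fun k : ℕ => wilsonExpectation (L := (ψ ∘ φ) k + 1) r.ρ β (toTorusObservable ((ψ ∘ φ) k + 1) F)) =
      fun k => ∫ U, Fb U ∂(P (ψ (φ k)) : Measure (LGConfig 4 G)) :=
    funext fun k => wilsonExpectation_toTorusObservable r.ρ β (ψ (φ k) + 1) hFc.measurable
  have key : Tendsto (fun k : ℕ => ∫ U, Fb U ∂(P (ψ (φ k)) : Measure (LGConfig 4 G))) atTop
      (𝓝 (∫ U, Fb U ∂(μ : Measure (LGConfig 4 G)))) :=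
    (ProbabilityMeasure.tendsto_iff_forall_integral_tendsto.1 hlim) Fb
  rw [hE]
  exact key

/-- **Convergence of the torus covariances along the tori defining a limit state**: if `μ` is the limit of the torus Wilson states
along `L_k + 1`, then `Cov_{β,Λ_{L_k+1}}(c₀, c_{n e₀}) → ∫ c₀ c_{n e₀} dμ − ∫ c₀ dμ · ∫ c_{n e₀} dμ` (the plaquette cost and its time
translate are bounded continuous cylinder observables). [folklore] -/
theorem tendsto_cov_along (β : ℝ) (n : ℕ) {Lk : ℕ → ℕ} {μ : Measure (LGConfig 4 G)}
    (hμ : IsInfiniteVolumeLimitAlong (d := 4) r.ρ β Lk μ) :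
    Tendsto (fun k => wilsonExpectation (L := Lk k + 1) r.ρ β (toTorusObservable (Lk k + 1) fun U =>
          plaqCost0 (d := 4) r.ρ 1 2 U * plaqCost0 (d := 4) r.ρ 1 2 (timeShiftLG (G := G) n U)) -
        wilsonExpectation (L := Lk k + 1) r.ρ β (toTorusObservable (Lk k + 1) (plaqCost0 (d := 4) r.ρ 1 2)) *
          wilsonExpectation (L := Lk k + 1) r.ρ β (toTorusObservable (Lk k + 1) fun U =>
            plaqCost0 (d := 4) r.ρ 1 2 (timeShiftLG (G := G) n U)))
      atTop (𝓝 ((∫ U, plaqCost0 (d := 4) r.ρ 1 2 U * plaqCost0 (d := 4) r.ρ 1 2 (timeShiftLG (G := G) n U) ∂μ) -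
        (∫ U, plaqCost0 (d := 4) r.ρ 1 2 U ∂μ) * ∫ U, plaqCost0 (d := 4) r.ρ 1 2 (timeShiftLG (G := G) n U) ∂μ)) := by
  obtain ⟨hcont, C, hC⟩ := continuous_bounded_plaqCost0 (d := 4) (G := G) r.ρ r.continuous 1 2
  obtain ⟨hcyl, -⟩ := plaqCost0_support (d := 4) (G := G) r.ρ (i := 1) (j := 2) (by decide) (by decide)
  have hcylG := isCylinder_timeShift hcyl n
  have hcontG : Continuous fun U : LGConfig 4 G => plaqCost0 (d := 4) r.ρ 1 2 (timeShiftLG (G := G) n U) :=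
    hcont.comp (continuous_timeShiftLG n)
  have hbdG : ∃ C', ∀ U : LGConfig 4 G, |plaqCost0 (d := 4) r.ρ 1 2 (timeShiftLG (G := G) n U)| ≤ C' := ⟨C, fun U => hC _⟩
  have hbdP : ∃ C', ∀ U : LGConfig 4 G,
      |plaqCost0 (d := 4) r.ρ 1 2 U * plaqCost0 (d := 4) r.ρ 1 2 (timeShiftLG (G := G) n U)| ≤ C' :=
    ⟨C * C, fun U => by
      rw [abs_mul]
      exact mul_le_mul (hC _) (hC _) (abs_nonneg _) ((abs_nonneg _).trans (hC U))⟩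
  have tF := hμ.2 _ _ hcyl hcont ⟨C, hC⟩
  have tG := hμ.2 _ _ hcylG hcontG hbdG
  have tP := hμ.2 _ _ (IsCylinder.mul hcyl hcylG) (hcont.mul hcontG) hbdP
  exact tP.sub (tF.mul tG)

/-- **Torus law ⇒ limit-state law**: if eventually in `L` the torus covariance satisfies `|β² Cov_{β,Λ_{L+1}} − σ S| ≤ ε`, then every
infinite-volume limit state `μ` at `β` satisfies `|β² Cov_μ − σ S| ≤ ε` (closed condition, limit along the defining tori). [folklore] -/
theorem limitStates_of_eventually (β : ℝ) (n : ℕ) {σ S ε : ℝ}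
    (h : ∀ᶠ L : ℕ in atTop, |β ^ 2 * (wilsonExpectation (L := L + 1) r.ρ β (toTorusObservable (L + 1) fun U =>
          plaqCost0 (d := 4) r.ρ 1 2 U * plaqCost0 (d := 4) r.ρ 1 2 (timeShiftLG (G := G) n U)) -
        wilsonExpectation (L := L + 1) r.ρ β (toTorusObservable (L + 1) (plaqCost0 (d := 4) r.ρ 1 2)) *
          wilsonExpectation (L := L + 1) r.ρ β (toTorusObservable (L + 1) fun U =>
            plaqCost0 (d := 4) r.ρ 1 2 (timeShiftLG (G := G) n U))) - σ * S| ≤ ε) :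
    ∀ μ ∈ infiniteVolumeLimitPoints (d := 4) r.ρ β,
      |β ^ 2 * ((∫ U, plaqCost0 (d := 4) r.ρ 1 2 U * plaqCost0 (d := 4) r.ρ 1 2 (timeShiftLG (G := G) n U) ∂μ) -
        (∫ U, plaqCost0 (d := 4) r.ρ 1 2 U ∂μ) * ∫ U, plaqCost0 (d := 4) r.ρ 1 2 (timeShiftLG (G := G) n U) ∂μ) - σ * S| ≤ ε := by
  intro μ hμ
  obtain ⟨Lk, hmono, hμL⟩ := hμ
  have t := tendsto_cov_along G r β n hμL
  have tabs := ((t.const_mul (β ^ 2)).sub_const (σ * S)).abs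
  exact le_of_tendsto tabs (hmono.tendsto_atTop.eventually h)

/-- **Limit-state law ⇒ torus law**: if every infinite-volume limit state `μ` at `β` satisfies `|β² Cov_μ − σ S| ≤ ε`, then for
every `δ > 0`, eventually in `L`, `|β² Cov_{β,Λ_{L+1}} − σ S| ≤ ε + δ` (compactness along subsequences + the real-sequence lemma).
[folklore] -/
theorem eventually_of_limitStates (β : ℝ) (n : ℕ) {σ S ε δ : ℝ} (hδ : 0 < δ)
    (h : ∀ μ ∈ infiniteVolumeLimitPoints (d := 4) r.ρ β,
      |β ^ 2 * ((∫ U, plaqCost0 (d := 4) r.ρ 1 2 U * plaqCost0 (d := 4) r.ρ 1 2 (timeShiftLG (G := G) n U) ∂μ) -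
        (∫ U, plaqCost0 (d := 4) r.ρ 1 2 U ∂μ) * ∫ U, plaqCost0 (d := 4) r.ρ 1 2 (timeShiftLG (G := G) n U) ∂μ) - σ * S| ≤ ε) :
    ∀ᶠ L : ℕ in atTop, |β ^ 2 * (wilsonExpectation (L := L + 1) r.ρ β (toTorusObservable (L + 1) fun U =>
          plaqCost0 (d := 4) r.ρ 1 2 U * plaqCost0 (d := 4) r.ρ 1 2 (timeShiftLG (G := G) n U)) -
        wilsonExpectation (L := L + 1) r.ρ β (toTorusObservable (L + 1) (plaqCost0 (d := 4) r.ρ 1 2)) *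
          wilsonExpectation (L := L + 1) r.ρ β (toTorusObservable (L + 1) fun U =>
            plaqCost0 (d := 4) r.ρ 1 2 (timeShiftLG (G := G) n U))) - σ * S| ≤ ε + δ := by
  refine eventually_abs_sub_le_of_subseq_limits (x := fun L => β ^ 2 *
      (wilsonExpectation (L := L + 1) r.ρ β (toTorusObservable (L + 1) fun U =>
          plaqCost0 (d := 4) r.ρ 1 2 U * plaqCost0 (d := 4) r.ρ 1 2 (timeShiftLG (G := G) n U)) -
        wilsonExpectation (L := L + 1) r.ρ β (toTorusObservable (L + 1) (plaqCost0 (d := 4) r.ρ 1 2)) *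
          wilsonExpectation (L := L + 1) r.ρ β (toTorusObservable (L + 1) fun U =>
            plaqCost0 (d := 4) r.ρ 1 2 (timeShiftLG (G := G) n U)))) hδ fun ψ hψ => ?_
  obtain ⟨φ, hφ, μ, hμ⟩ := exists_limitAlong_subseq G r β ψ
  have hmem : μ ∈ infiniteVolumeLimitPoints (d := 4) r.ρ β := ⟨ψ ∘ φ, hψ.comp hφ, hμ⟩
  refine ⟨φ, hφ, _, h μ hmem, ?_⟩
  exact (tendsto_cov_along G r β n hμ).const_mul (β ^ 2)

end Wilson

/-! ### The crux in limit-state form -/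

/-- **`EntropyBudgetTransfer` ⇔ the two-sided free-gluon law for all torus-limit states.**  The crux of route
`EntropyBudgetEquipartition` (K1's body ⇒ the two-sided law eventually on the tori; K1 is proved, `FreeEnergyRate_of`) holds iff
for every compact simple `G` and lattice representation `r` there are `κ, A, σ > 0`, `C`, `β₀` with
`|β² Cov_μ(c₀, c_{n e₀}) − σ C(n)²| ≤ C β^(−κ)` for all `β ≥ β₀`, `1 ≤ n ≤ 2β^A` and every `μ ∈ infiniteVolumeLimitPoints r.ρ β`
(`⇒` with the same constants, `⇐` with `C + 1` and `β₀ ⊔ 1`).  A reformulation of a RECORD-label rung crux; NOT the Clay gap.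
[folklore] -/
theorem entropyBudgetTransfer_iff_limitStates :
    Summit.QuantumFields.YangMills.Theses.EntropyBudgetEquipartition.EntropyBudgetTransfer ↔
      ∀ (G : Type) [Group G] [TopologicalSpace G] [IsTopologicalGroup G] [CompactSpace G], IsCompactSimpleLieGroup G →
        letI : MeasurableSpace G := borel G; haveI : BorelSpace G := ⟨rfl⟩; ∀ r : LatticeRep G,
        ∃ κ A C σ β₀ : ℝ, 0 < κ ∧ 0 < A ∧ 0 < σ ∧ ∀ β : ℝ, β₀ ≤ β → ∀ n : ℕ, 1 ≤ n → (n : ℝ) ≤ 2 * β ^ A →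
          ∀ μ ∈ infiniteVolumeLimitPoints (d := 4) r.ρ β,
            |β ^ 2 * ((∫ U, plaqCost0 (d := 4) r.ρ 1 2 U * plaqCost0 (d := 4) r.ρ 1 2 (timeShiftLG (G := G) n U) ∂μ) -
              (∫ U, plaqCost0 (d := 4) r.ρ 1 2 U ∂μ) * ∫ U, plaqCost0 (d := 4) r.ρ 1 2 (timeShiftLG (G := G) n U) ∂μ) -
              σ * (curvaturePlaquetteCorr (d := 4) (by norm_num) (n : ℤ)) ^ 2| ≤ C * β ^ (-κ) := by
  rw [entropyBudgetTransfer_iff_twoSidedLaw]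
  constructor
  · intro h G _ _ _ _ hG
    letI : MeasurableSpace G := borel G
    haveI : BorelSpace G := ⟨rfl⟩
    intro r
    obtain ⟨κ, A, C, σ, β₀, hκ, hA, hσ, hlaw⟩ := h G hG r
    refine ⟨κ, A, C, σ, β₀, hκ, hA, hσ, fun β hβ n hn1 hn2 => ?_⟩
    exact limitStates_of_eventually G r β n (hlaw β hβ n hn1 hn2)
  · intro h G _ _ _ _ hG
    letI : MeasurableSpace G := borel G
    haveI : BorelSpace G := ⟨rfl⟩
    intro r
    obtain ⟨κ, A, C, σ, β₀, hκ, hA, hσ, hlaw⟩ := h G hG r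
    refine ⟨κ, A, C + 1, σ, max β₀ 1, hκ, hA, hσ, fun β hβ n hn1 hn2 => ?_⟩
    have hβ₀ : β₀ ≤ β := (le_max_left _ _).trans hβ
    have hβpos : 0 < β := lt_of_lt_of_le one_pos ((le_max_right _ _).trans hβ)
    have hδ : 0 < β ^ (-κ) := Real.rpow_pos_of_pos hβpos _
    have ev := eventually_of_limitStates G r β n hδ (hlaw β hβ₀ n hn1 hn2)
    filter_upwards [ev] with L hL
    linarith

end Summit.QuantumFields.YangMills.Theorems.EntropyBudgetEquipartition.LimitStates

end
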